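import Mathlib
import Summits.ResolutionOfSingularities.ResolutionOfSingularities.Theorems.RadicialJungCleanModelsCleanProp44NearLineFinal
import HarnessLib

/-!
# Route `RadicialJung`, crux `CleanModels` (stmt-ResolutionOfSingularities-15917), line `Sketch` rev 35, stub 6 `stub_cleanProp44` (X44c):
# CLEAN-PERMISSIBILITY OF NEAR LINES, X — the consumer's form: straight from `CleanRegAt` at the blown-up point

Seat decomp-res-hand-2 g18 (structural hand).  ✓ `cleanPermissibleAt_nearLine_or_corner_or_birth` (`…CleanProp44NearLineFinal.lean`) asks for
the clean data at `x` in form-(1) currency `(c, w = ∅, u, a)` with every exponent zero or prime to `p`; here this is DERIVED from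
`CleanRegAt p (𝒪_{X,x} → K(X)) G` (the standing hypothesis of the (R1ᵐⁱⁿ) stages: the line is clean-regular at every point), so that the
(R1ᵐⁱⁿ)/(R3ᵐⁱⁿ′) provers can cite ONE theorem:

* `exists_cleanRegAt_normalForm` — `CleanRegAt p f G` ⟹ a regular system of parameters `c : Fin n → R` of `R` (`(c) = 𝔪`, `dim R = n`), a unit
  `u`, exponents `a` ALL zero or prime to `p`, and a non-trivial representative `Σ c_j^p G^j = f(u · ∏ c_k^{a_k})` (form (1): the printed exponents
  padded by zeros; form (2): `a = 0`; form (3): the shifted representative with the regular parameter `s - c^p` as a coordinate, exponent `1`).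
* `cleanPermissibleAt_nearLine_or_corner_or_birth_of_cleanRegAt` (appended: `…_of_isRsopPart`, the near-line data as an rsop PAIR
  `(e', y')`, ✓ `exists_span_triple_eq_of_isRsopPart_pair`) — `τ : X' → X` a blowing up along `J` with `J_x = 𝔪_x` at `x = τ x'`
  (`IsBlowup`), the line of `G` CLEAN-REGULAR at `x`, `dim 𝒪_{X',x'} = 3`, and `x'` on the near line `N = (e', y')` of a regular parameter `t_{j₀}`
  (`(e') = 𝔪_x 𝒪_{X',x'}`, `τ^♯ t_{j₀} = e' y'`, `y' ∈ 𝔪_{x'}`, `(e', y', z')` a regular system): for SOME such normal form `(c, u, a, cc)` at `x`,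
  the line of `τ^♯ G` is CLEAN-PERMISSIBLE at `x'` for `N`, OR `x'` is a CORNER of the clean divisor `∏_{a_k ≠ 0} V(c_k)` met by `N` in a non-axis
  direction, OR `x'` is a BIRTH of `N`.

Honest framing: OURS; a TOOL (lemma (ii) of hand-2 g17's census, consumer form).  Nothing here proves X44c, any case of `CleanModels`, or
resolution of singularities in characteristic `p`.  Setting only: [cite: CossartPiltant2008, Lemma 4.3 (5); Prop. 4.4] [cite: Piltant2013, §2 Axiom 4]
[cite: Matsumura1987, Thm. 14.2].
-/

noncomputable section

set_option linter.dupNamespace false -- mandated namespace of this single-conjunct summit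

open IsLocalRing CategoryTheory AlgebraicGeometry
open Literature.AlgebraicGeometry.Resolution Literature.AlgebraicGeometry.Motives

namespace Summit.ResolutionOfSingularities.ResolutionOfSingularities.Theorems.RadicialJung.CleanModels

universe u

/-! ## §1 `CleanRegAt` in form-(1) currency with all exponents zero or prime to `p` -/

/-- **Normal form of a clean-regular line at a point** (✓ `cleanPermissible_of_cleanRegAt` keeping track of the exponents): a regular system
of parameters `c` of `R`, a unit `u`, exponents `a` each zero or prime to `p`, and a non-trivial representative `f(u ∏ c_k^{a_k})`.
[cite: Piltant2013, §2 Axiom 4] [cite: Matsumura1987, Thm. 14.2] -/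
theorem exists_cleanRegAt_normalForm {R F : Type u} [CommRing R] [Field F] (p : ℕ) [hp : Fact p.Prime] [CharP F p] (f : R →+* F)
    {G : F} (h : CleanRegAt p f G) :
    ∃ (_ : IsRegularLocalRing R) (n : ℕ) (c : Fin n → R) (cc : Fin p → F) (u : R) (a : Fin n → ℕ),
      Ideal.span (Set.range c) = maximalIdeal R ∧ ringKrullDim R = (n : WithBot ℕ∞) ∧ (∃ j : Fin p, (j : ℕ) ≠ 0 ∧ cc j ≠ 0) ∧
      IsUnit u ∧ (∀ k, a k = 0 ∨ ¬ p ∣ a k) ∧ (∑ j : Fin p, cc j ^ p * G ^ (j : ℕ)) = f (u * ∏ k, c k ^ a k) := by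
  classical
  obtain ⟨hreg, cc, hcc, hform⟩ := h
  rcases hform with ⟨d, m, hmd, t, a, u, hu, hspan, hdim, hm, ha, hX⟩ | ⟨u, hu, hX, hup⟩ | ⟨s, c₁, hX, h1, h2⟩
  · -- form (1): exponents `a` on the first `m` coordinates, `0` on the others
    let emb : Fin m ↪ Fin d := ⟨Fin.castLE hmd, Fin.castLE_injective hmd⟩
    let a' : Fin d → ℕ := fun k => if hk : ∃ i : Fin m, Fin.castLE hmd i = k then a hk.choose else 0
    have ha'emb : ∀ i : Fin m, a' (Fin.castLE hmd i) = a i := by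
      intro i
      have hk : ∃ i' : Fin m, Fin.castLE hmd i' = Fin.castLE hmd i := ⟨i, rfl⟩
      simp only [a', hk, dif_pos]
      congr 1
      exact Fin.castLE_injective hmd hk.choose_spec
    have hprod : ∏ k, t k ^ a' k = ∏ i : Fin m, t (Fin.castLE hmd i) ^ a i := by
      have h1 : ∏ i : Fin m, t (Fin.castLE hmd i) ^ a i = ∏ k ∈ Finset.univ.map emb, t k ^ a' k := by
        rw [Finset.prod_map]
        exact Finset.prod_congr rfl fun i _ => by rw [show emb i = Fin.castLE hmd i from rfl, ha'emb]
      rw [h1]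
      symm
      refine Finset.prod_subset (Finset.subset_univ _) fun k _ hk => ?_
      have hk' : ¬ ∃ i : Fin m, Fin.castLE hmd i = k := by
        rintro ⟨i, rfl⟩
        exact hk (Finset.mem_map.mpr ⟨i, Finset.mem_univ _, rfl⟩)
      simp only [a', hk', dif_neg, not_false_eq_true, pow_zero]
    have hall : ∀ k, a' k = 0 ∨ ¬ p ∣ a' k := by
      intro k
      by_cases hk : ∃ i : Fin m, Fin.castLE hmd i = k
      · obtain ⟨i, rfl⟩ := hk
        exact Or.inr (by rw [ha'emb]; exact ha i)
      · exact Or.inl (by simp only [a', hk, dif_neg, not_false_eq_true])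
    exact ⟨hreg, d, t, cc, u, a', hspan, hdim, hcc, hu, hall, by rw [hX, hprod]⟩
  · -- form (2): any regular system of parameters, all exponents `0`
    obtain ⟨t, ht⟩ := exists_regularSystemOfParameters (R := R)
    refine ⟨hreg, _, t, cc, u, fun _ => 0, ht, ?_, hcc, hu, fun _ => Or.inl rfl, by rw [hX]; simp⟩
    rw [← IsRegularLocalRing.spanFinrank_maximalIdeal (R := R)]
  · -- form (3): shift the representative by `f(c₁)^p`; the regular parameter `s - c₁^p` is a coordinate with exponent `1`
    obtain ⟨d, hd0, t, hspan, hdim, ht0⟩ := stub_extendParameter (s - c₁ ^ p) h1 h2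
    obtain ⟨cc', hcc', hsum⟩ := exists_rep_twist p G cc hcc 1 (f c₁) one_ne_zero
    let a' : Fin d → ℕ := fun k => if k = ⟨0, hd0⟩ then 1 else 0
    have hprod : ∏ k, t k ^ a' k = t ⟨0, hd0⟩ := by
      rw [Finset.prod_eq_single ⟨0, hd0⟩ (fun k _ hk => by simp [a', hk]) (fun h => absurd (Finset.mem_univ _) h)]
      simp [a']
    have hall : ∀ k, a' k = 0 ∨ ¬ p ∣ a' k := by
      intro k
      by_cases hk : k = ⟨0, hd0⟩
      · exact Or.inr (by simp only [a', hk, if_true]; exact hp.out.not_dvd_one)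
      · exact Or.inl (by simp only [a', hk, if_false])
    refine ⟨hreg, d, t, cc', 1, a', hspan, hdim, hcc', isUnit_one, hall, ?_⟩
    rw [hsum, one_pow, one_mul, hX, ← map_pow, ← map_sub, hprod, ht0, one_mul]

/-! ## §2 The consumer's form of lemma (ii) -/

section Scheme

variable {p : ℕ} {X X' : Scheme.{u}} [IsIntegral X] [IsIntegral X'] {τ : X' ⟶ X} [IsDominant τ] {J : X.IdealSheafData}

set_option maxHeartbeats 800000 in
-- long statement, short proof
/-- **Lemma (ii), consumer form: on a near line of the blowing up of a CLEAN-REGULAR point only corners and births obstruct.**  See the module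
docstring; the normal form `(c, u, a, cc)` at `x` in which the corner / birth are expressed is produced by ✓ `exists_cleanRegAt_normalForm`.
[cite: CossartPiltant2008, Lemma 4.3 (5); Prop. 4.4 (proof, p. 11)] [cite: Piltant2013, §2 Axiom 4] -/
theorem cleanPermissibleAt_nearLine_or_corner_or_birth_of_cleanRegAt [Fact p.Prime] [CharP X.functionField p] (hτ : IsBlowup τ J)
    (x' : X') (hJ : stalkIdeal J (τ x') = maximalIdeal (X.presheaf.stalk (τ x'))) {G : X.functionField}
    (hclean : CleanRegAt p (RatFn.toFunctionField (τ x')) G) (hdim' : ringKrullDim (X'.presheaf.stalk x') = 3)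
    {d : ℕ} (t : Fin d → X.presheaf.stalk (τ x')) (hspan : Ideal.span (Set.range t) = maximalIdeal (X.presheaf.stalk (τ x')))
    (hdimd : ringKrullDim (X.presheaf.stalk (τ x')) = (d : WithBot ℕ∞)) (j₀ : Fin d) {e' y' z' : X'.presheaf.stalk x'}
    (he' : Ideal.span {e'} = (maximalIdeal (X.presheaf.stalk (τ x'))).map (τ.stalkMap x').hom)
    (hy' : (τ.stalkMap x').hom (t j₀) = e' * y') (hy'm : y' ∈ maximalIdeal (X'.presheaf.stalk x'))
    (hzz : Ideal.span ({e', y', z'} : Set (X'.presheaf.stalk x')) = maximalIdeal (X'.presheaf.stalk x')) :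
    ∃ (n : ℕ) (c : Fin n → X.presheaf.stalk (τ x')) (cc : Fin p → X.functionField) (u : X.presheaf.stalk (τ x')) (a : Fin n → ℕ),
      Ideal.span (Set.range c) = maximalIdeal (X.presheaf.stalk (τ x')) ∧ (∃ j : Fin p, (j : ℕ) ≠ 0 ∧ cc j ≠ 0) ∧ IsUnit u ∧
      (∀ k, a k = 0 ∨ ¬ p ∣ a k) ∧ (∑ j : Fin p, cc j ^ p * G ^ (j : ℕ)) = RatFn.toFunctionField (τ x') (u * ∏ k, c k ^ a k) ∧
      (CleanPermissibleAt p (RatFn.toFunctionField x') (RatFn.functionFieldMap τ G) (Ideal.span ({e', y'} : Set (X'.presheaf.stalk x'))) ∨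
      (∃ (k₁ k₂ : Fin n) (s₁ s₂ : X'.presheaf.stalk x'), k₁ ≠ k₂ ∧ a k₁ ≠ 0 ∧ a k₂ ≠ 0 ∧
          (τ.stalkMap x').hom (c k₁) = e' * s₁ ∧ (τ.stalkMap x').hom (c k₂) = e' * s₂ ∧
          Ideal.span ({e', s₁, s₂} : Set (X'.presheaf.stalk x')) = maximalIdeal (X'.presheaf.stalk x') ∧
          s₁ ∉ Ideal.span ({e', y'} : Set (X'.presheaf.stalk x')) ∧ s₂ ∉ Ideal.span ({e', y'} : Set (X'.presheaf.stalk x'))) ∨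
      (p ∣ ∑ k, a k ∧ (∀ k, a k ≠ 0 → Ideal.span {(τ.stalkMap x').hom (c k)} = (maximalIdeal (X.presheaf.stalk (τ x'))).map (τ.stalkMap x').hom) ∧
        ∃ U : X'.presheaf.stalk x', IsUnit U ∧
          (∑ j : Fin p, RatFn.functionFieldMap τ (cc j) ^ p * RatFn.functionFieldMap τ G ^ (j : ℕ)) =
            RatFn.toFunctionField x' (U * e' ^ (∑ k, a k)) ∧
          ¬ ((∀ c' : X'.presheaf.stalk x', U - c' ^ p ∉ maximalIdeal (X'.presheaf.stalk x')) ∨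
            (∃ c' : X'.presheaf.stalk x', U - c' ^ p ∈ maximalIdeal (X'.presheaf.stalk x') ∧
              U - c' ^ p ∉ Ideal.span ({e', y'} : Set (X'.presheaf.stalk x')) ⊔ maximalIdeal (X'.presheaf.stalk x') ^ 2) ∨
            (∃ c' : X'.presheaf.stalk x', U - c' ^ p ∈ Ideal.span ({e', y'} : Set (X'.presheaf.stalk x')) ∧
              U - c' ^ p ∉ maximalIdeal (X'.presheaf.stalk x') ^ 2)))) := by
  classical
  haveI : CharP X'.functionField p := charP_of_injective_ringHom (RatFn.functionFieldMap τ).injective p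
  obtain ⟨hR, n, c, cc, u, a, hc, hdim, hcc, hu, hall, hrep⟩ := exists_cleanRegAt_normalForm p (RatFn.toFunctionField (τ x')) hclean
  -- the form-(1) currency of the classification: `w = ∅`, `b = ∅`
  have hz : Ideal.span (Set.range (Fin.append c Fin.elim0)) = maximalIdeal (X.presheaf.stalk (τ x')) := by
    rw [Fin.append_elim0]
    have hsurj : Function.Surjective (Fin.cast (Nat.add_zero n)) := fun i => ⟨Fin.cast (Nat.add_zero n).symm i, Fin.ext rfl⟩
    rw [hsurj.range_comp, hc]
  have hdim0 : ringKrullDim (X.presheaf.stalk (τ x')) = ((n + 0 : ℕ) : WithBot ℕ∞) := by rw [Nat.add_zero]; exact hdim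
  have hcJ : Ideal.span (Set.range c) = stalkIdeal J (τ x') := hc.trans hJ.symm
  have hrep' : (∑ j : Fin p, cc j ^ p * G ^ (j : ℕ)) =
      RatFn.toFunctionField (τ x') (u * (∏ k, c k ^ a k) * ∏ m : Fin 0, (Fin.elim0 m : X.presheaf.stalk (τ x')) ^ (Fin.elim0 m : ℕ)) := by
    rw [hrep, Fin.prod_univ_zero, mul_one]
  have he'J : Ideal.span {e'} = (stalkIdeal J (τ x')).map (τ.stalkMap x').hom := by rw [hJ]; exact he'
  refine ⟨n, c, cc, u, a, hc, hcc, hu, hall, hrep, ?_⟩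
  rcases cleanPermissibleAt_nearLine_or_corner_or_birth hτ x' hR c Fin.elim0 hz hdim0 hcJ hJ hcc hu hrep' (fun m => m.elim0) hall hdim'
      t hspan hdimd j₀ he'J hy' hy'm hzz with h | h | ⟨hA, hsides, hU⟩
  · exact Or.inl h
  · exact Or.inr (Or.inl h)
  · refine Or.inr (Or.inr ⟨hA, fun k hk => ?_, hU⟩)
    rw [hsides k hk, hJ]

/-- Bookkeeping: a pair `(e', y')` which is part of a regular system of parameters of a `3`-dimensional local ring extends to a generating
triple `(e', y', z')` of `𝔪`. [cite: Matsumura1987, Thm. 14.2] -/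
theorem exists_span_triple_eq_of_isRsopPart_pair {S : Type u} [CommRing S] [IsLocalRing S] {e' y' : S} (hpair : IsRsopPart ![e', y'])
    (hdim : ringKrullDim S = 3) : ∃ z' : S, Ideal.span ({e', y', z'} : Set S) = maximalIdeal S := by
  haveI := hpair.isRegularLocalRing
  obtain ⟨e, x, hrank, hspan, hx⟩ := hpair.exists_rsop
  have he : e = 1 := by
    have h1 := IsRegularLocalRing.spanFinrank_maximalIdeal (R := S)
    rw [hrank, hdim] at h1
    have h2 : (2 + e : ℕ) = 3 := by exact_mod_cast h1
    omega
  subst he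
  refine ⟨x (Fin.natAdd 2 0), ?_⟩
  rw [← hspan]
  congr 1
  ext r
  simp only [Set.mem_insert_iff, Set.mem_singleton_iff, Set.mem_range]
  constructor
  · rintro (rfl | rfl | rfl)
    · exact ⟨Fin.castAdd 1 0, by rw [hx]; rfl⟩
    · exact ⟨Fin.castAdd 1 1, by rw [hx]; rfl⟩
    · exact ⟨Fin.natAdd 2 0, rfl⟩
  · rintro ⟨i, rfl⟩
    refine Fin.addCases (fun i₁ => ?_) (fun i₂ => ?_) i
    · rw [hx]
      fin_cases i₁
      · exact Or.inl rfl
      · exact Or.inr (Or.inl rfl)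
    · fin_cases i₂
      exact Or.inr (Or.inr rfl)

set_option maxHeartbeats 800000 in
-- long statement, short proof
/-- **Lemma (ii), consumer form with the near-line data as the tree serves it**: the pair `(e', y')` part of a regular system of parameters of the
`3`-dimensional `𝒪_{X',x'}` (✓ `NearPointsPointCentreLineCurve.lean`: rsop pairs along the line) instead of an explicit third parameter.
[cite: CossartPiltant2008, Lemma 4.3 (5); Prop. 4.4 (proof, p. 11)] [cite: Piltant2013, §2 Axiom 4] -/
theorem cleanPermissibleAt_nearLine_or_corner_or_birth_of_cleanRegAt_of_isRsopPart [Fact p.Prime] [CharP X.functionField p]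
    (hτ : IsBlowup τ J) (x' : X') (hJ : stalkIdeal J (τ x') = maximalIdeal (X.presheaf.stalk (τ x'))) {G : X.functionField}
    (hclean : CleanRegAt p (RatFn.toFunctionField (τ x')) G) (hdim' : ringKrullDim (X'.presheaf.stalk x') = 3)
    {d : ℕ} (t : Fin d → X.presheaf.stalk (τ x')) (hspan : Ideal.span (Set.range t) = maximalIdeal (X.presheaf.stalk (τ x')))
    (hdimd : ringKrullDim (X.presheaf.stalk (τ x')) = (d : WithBot ℕ∞)) (j₀ : Fin d) {e' y' : X'.presheaf.stalk x'}
    (he' : Ideal.span {e'} = (maximalIdeal (X.presheaf.stalk (τ x'))).map (τ.stalkMap x').hom)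
    (hy' : (τ.stalkMap x').hom (t j₀) = e' * y') (hpair : IsRsopPart ![e', y']) :
    ∃ (n : ℕ) (c : Fin n → X.presheaf.stalk (τ x')) (cc : Fin p → X.functionField) (u : X.presheaf.stalk (τ x')) (a : Fin n → ℕ),
      Ideal.span (Set.range c) = maximalIdeal (X.presheaf.stalk (τ x')) ∧ (∃ j : Fin p, (j : ℕ) ≠ 0 ∧ cc j ≠ 0) ∧ IsUnit u ∧
      (∀ k, a k = 0 ∨ ¬ p ∣ a k) ∧ (∑ j : Fin p, cc j ^ p * G ^ (j : ℕ)) = RatFn.toFunctionField (τ x') (u * ∏ k, c k ^ a k) ∧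
      (CleanPermissibleAt p (RatFn.toFunctionField x') (RatFn.functionFieldMap τ G) (Ideal.span ({e', y'} : Set (X'.presheaf.stalk x'))) ∨
      (∃ (k₁ k₂ : Fin n) (s₁ s₂ : X'.presheaf.stalk x'), k₁ ≠ k₂ ∧ a k₁ ≠ 0 ∧ a k₂ ≠ 0 ∧
          (τ.stalkMap x').hom (c k₁) = e' * s₁ ∧ (τ.stalkMap x').hom (c k₂) = e' * s₂ ∧
          Ideal.span ({e', s₁, s₂} : Set (X'.presheaf.stalk x')) = maximalIdeal (X'.presheaf.stalk x') ∧
          s₁ ∉ Ideal.span ({e', y'} : Set (X'.presheaf.stalk x')) ∧ s₂ ∉ Ideal.span ({e', y'} : Set (X'.presheaf.stalk x'))) ∨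
      (p ∣ ∑ k, a k ∧ (∀ k, a k ≠ 0 → Ideal.span {(τ.stalkMap x').hom (c k)} = (maximalIdeal (X.presheaf.stalk (τ x'))).map (τ.stalkMap x').hom) ∧
        ∃ U : X'.presheaf.stalk x', IsUnit U ∧
          (∑ j : Fin p, RatFn.functionFieldMap τ (cc j) ^ p * RatFn.functionFieldMap τ G ^ (j : ℕ)) =
            RatFn.toFunctionField x' (U * e' ^ (∑ k, a k)) ∧
          ¬ ((∀ c' : X'.presheaf.stalk x', U - c' ^ p ∉ maximalIdeal (X'.presheaf.stalk x')) ∨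
            (∃ c' : X'.presheaf.stalk x', U - c' ^ p ∈ maximalIdeal (X'.presheaf.stalk x') ∧
              U - c' ^ p ∉ Ideal.span ({e', y'} : Set (X'.presheaf.stalk x')) ⊔ maximalIdeal (X'.presheaf.stalk x') ^ 2) ∨
            (∃ c' : X'.presheaf.stalk x', U - c' ^ p ∈ Ideal.span ({e', y'} : Set (X'.presheaf.stalk x')) ∧
              U - c' ^ p ∉ maximalIdeal (X'.presheaf.stalk x') ^ 2)))) := by
  obtain ⟨z', hzz⟩ := exists_span_triple_eq_of_isRsopPart_pair hpair hdim'
  have hy'm : y' ∈ maximalIdeal (X'.presheaf.stalk x') := by simpa using hpair.mem_maximalIdeal 1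
  exact cleanPermissibleAt_nearLine_or_corner_or_birth_of_cleanRegAt hτ x' hJ hclean hdim' t hspan hdimd j₀ he' hy' hy'm hzz

end Scheme

end Summit.ResolutionOfSingularities.ResolutionOfSingularities.Theorems.RadicialJung.CleanModels

end
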